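import Summits.QuantumFields.YangMills.Theses.RenyiTelescope

/-!
# Route `RenyiTelescope` — glue item `HistoryTailOfRenyiTelescope` (stmt-QuantumFields-27139): THE TELESCOPED CRUX
# (support file; ideator seat `ym-r3-idea-2` g3, registered stub `stub_telescopedCrux` of the glue skeleton v6)

THE STEP (G3-instantiation of the glue plan attached to the item).  Crux `CutoffRenyiL` (stmt-QuantumFields-27137) is a ONE-STEP conditional
Rényi comparison of consecutive cut-offs with a free Hölder order `1 < q ≤ Q·L^(2J)`.  This file runs it up the cut-offs for a refined family
`F.refine d` (coupling `γ_d = γL^(−d)`) with the GEOMETRIC ORDERS `q_J = κ·L^(2J)` and proves (`stub_telescopedCrux`): if `κ ≤ Q`,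
`κ·L^(2J₀) ≥ 3` (so every `q_J > 1` and the order budget `Σ_(J ≥ J₀) 1/q_J ≤ (4/3)/(κL^(2J₀)) ≤ 4/9 ≤ 1/2` closes) and the interior events
have Gibbs mass `≥ 1/2` at every cut-off in `[J₀, J]`, then the unit-event mass at cut-off `J` is at most
  `exp((4/3)·R₀·κ·p(g_d)⁴·L^(3(m+d))/L^(2J₀)) · (u_(J₀)/P_(J₀))^(1/2)`
— the exponent being the geometric sum of the one-step exponents `R₀(q_J − 1)p(g_d)⁴L^(3(m+d))/L^(4J) ≤ R₀κp⁴L^(3(m+d))·L^(−2J)`.  Ingredients: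
the crux (hypothesis), the conditional telescope (`stub_conditionalTelescope`, landed; taken as a hypothesis), the geometric series with ratio
`1/L² ≤ 1/4` (`geom_sum_quarter`, `order_budget`, `exponent_budget`), measurability of the unit-plaquette event, `Gibbs ≤ 1`.
`R₀` is replaced by `max R₀ 0 ≥ 0` (the crux's bound only weakens).

WHAT THIS IS NOT: the crux `CutoffRenyiL` is a HYPOTHESIS here and stays open; choosing `J₀ = J₀(d)` (the fine regime of crux `FineRegimeUnitTailL`),
`κ`, and closing the interior masses `≥ 1/2` is the remaining registered stub `stub_glueRest` (with `stub_abstractBootstrap`, `stub_interiorComplement`);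
nothing here bears on the Yang–Mills mass gap and the rung R3 (`YM3TorusSU2`) is NOT proved.

References: T. Bałaban, CMP 102 (1985) 255–275 [Balaban1985UV3] ((7) p.257, (71) p.273); C. King, CMP 103 (1986) 323–349 [King1986]
(Thm 3.4 (3.9): the run-by-run telescope).
-/

noncomputable section

open MeasureTheory
open Literature.MathematicalPhysics.QuantumFieldTheory.Balaban1983to89
open Literature.MathematicalPhysics.QuantumFieldTheory.Balaban1983to89.T3ContinuumYM3Torus
open Literature.MathematicalPhysics.QuantumFieldTheory.Balaban1983to89.T3UnitScaleTilt
open Literature.MathematicalPhysics.QuantumFieldTheory.Balaban1983to89.T3UnitLawDensityEML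
open Literature.MathematicalPhysics.QuantumFieldTheory.Balaban1983to89.T3InteriorExcision

namespace Summit.QuantumFields.YangMills.Theorems.RenyiTelescope

/-! ## §1 Geometric sums with ratio `≤ 1/4` -/

/-- `Σ_(i<n) r^i ≤ 4/3` for `0 ≤ r ≤ 1/4`. [folklore] -/
theorem geom_sum_quarter (r : ℝ) (h0 : 0 ≤ r) (h4 : r ≤ 1 / 4) (n : ℕ) : ∑ i ∈ Finset.range n, r ^ i ≤ 4 / 3 := by
  have h1 : r < 1 := by linarith
  calc ∑ i ∈ Finset.range n, r ^ i ≤ ∑' i, r ^ i :=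
        (summable_geometric_of_lt_one h0 h1).sum_le_tsum (Finset.range n) fun i _ => pow_nonneg h0 i
    _ = (1 - r)⁻¹ := tsum_geometric_of_lt_one h0 h1
    _ ≤ 4 / 3 := by
        rw [inv_le_comm₀ (by linarith) (by norm_num)]
        linarith

/-- The ratio: `1/L² ≤ 1/4` for `L ≥ 2`. [folklore] -/
theorem one_div_sq_le_quarter {L : ℝ} (hL : 2 ≤ L) : 1 / L ^ 2 ≤ 1 / 4 :=
  one_div_le_one_div_of_le (by norm_num) (by nlinarith)

/-- THE ORDER BUDGET: with `q_J = κL^(2J)` and `κL^(2J₀) ≥ 3`, `Σ_(i<n) 1/q_(J₀+i) ≤ 1/2`. [folklore] -/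
theorem order_budget {L κ : ℝ} (hL : 2 ≤ L) (hκ : 0 < κ) {J₀ : ℕ} (h3 : 3 ≤ κ * L ^ (2 * J₀)) (n : ℕ) :
    ∑ i ∈ Finset.range n, 1 / (κ * L ^ (2 * (J₀ + i))) ≤ 1 / 2 := by
  have hL0 : 0 < L := by linarith
  have hterm : ∀ i : ℕ, 1 / (κ * L ^ (2 * (J₀ + i))) = 1 / (κ * L ^ (2 * J₀)) * (1 / L ^ 2) ^ i := by
    intro i
    rw [one_div_pow, one_div_mul_one_div, ← pow_mul, mul_assoc, ← pow_add, ← mul_add]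
  calc ∑ i ∈ Finset.range n, 1 / (κ * L ^ (2 * (J₀ + i)))
      = ∑ i ∈ Finset.range n, 1 / (κ * L ^ (2 * J₀)) * (1 / L ^ 2) ^ i := Finset.sum_congr rfl fun i _ => hterm i
    _ = 1 / (κ * L ^ (2 * J₀)) * ∑ i ∈ Finset.range n, (1 / L ^ 2) ^ i := by rw [Finset.mul_sum]
    _ ≤ 1 / (κ * L ^ (2 * J₀)) * (4 / 3) :=
        mul_le_mul_of_nonneg_left (geom_sum_quarter _ (by positivity) (one_div_sq_le_quarter hL) n) (by positivity)
    _ ≤ 1 / 3 * (4 / 3) := by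
        refine mul_le_mul_of_nonneg_right ?_ (by norm_num)
        rw [div_le_iff₀ (by positivity)]
        linarith
    _ ≤ 1 / 2 := by norm_num

/-- THE EXPONENT BUDGET: `Σ_(i<n) R(κL^(2(J₀+i)) − 1)W₁W₂/L^(4(J₀+i)) ≤ (4/3)RκW₁W₂/L^(2J₀)` for `R, W₁, W₂ ≥ 0`, `L ≥ 2`. [folklore] -/
theorem exponent_budget {L κ R W₁ W₂ : ℝ} (hL : 2 ≤ L) (hκ : 0 < κ) (hR : 0 ≤ R) (hW₁ : 0 ≤ W₁) (hW₂ : 0 ≤ W₂) (J₀ n : ℕ) :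
    ∑ i ∈ Finset.range n, R * (κ * L ^ (2 * (J₀ + i)) - 1) * W₁ * W₂ / L ^ (4 * (J₀ + i)) ≤
      4 / 3 * R * κ * W₁ * W₂ / L ^ (2 * J₀) := by
  have hL0 : 0 < L := by linarith
  have hterm : ∀ i : ℕ, R * (κ * L ^ (2 * (J₀ + i)) - 1) * W₁ * W₂ / L ^ (4 * (J₀ + i)) ≤
      R * κ * W₁ * W₂ / L ^ (2 * J₀) * (1 / L ^ 2) ^ i := by
    intro i
    have h1 : R * (κ * L ^ (2 * (J₀ + i)) - 1) * W₁ * W₂ / L ^ (4 * (J₀ + i)) ≤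
        R * (κ * L ^ (2 * (J₀ + i))) * W₁ * W₂ / L ^ (4 * (J₀ + i)) := by
      refine div_le_div_of_nonneg_right ?_ (by positivity)
      refine mul_le_mul_of_nonneg_right (mul_le_mul_of_nonneg_right ?_ hW₁) hW₂
      exact mul_le_mul_of_nonneg_left (by linarith) hR
    refine h1.trans (le_of_eq ?_)
    rw [one_div_pow, mul_one_div, div_div, div_eq_div_iff (by positivity) (by positivity), ← pow_mul]
    ring
  calc ∑ i ∈ Finset.range n, R * (κ * L ^ (2 * (J₀ + i)) - 1) * W₁ * W₂ / L ^ (4 * (J₀ + i))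
      ≤ ∑ i ∈ Finset.range n, R * κ * W₁ * W₂ / L ^ (2 * J₀) * (1 / L ^ 2) ^ i := Finset.sum_le_sum fun i _ => hterm i
    _ = R * κ * W₁ * W₂ / L ^ (2 * J₀) * ∑ i ∈ Finset.range n, (1 / L ^ 2) ^ i := by rw [Finset.mul_sum]
    _ ≤ R * κ * W₁ * W₂ / L ^ (2 * J₀) * (4 / 3) :=
        mul_le_mul_of_nonneg_left (geom_sum_quarter _ (by positivity) (one_div_sq_le_quarter hL) n) (by positivity)
    _ = 4 / 3 * R * κ * W₁ * W₂ / L ^ (2 * J₀) := by ring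

/-! ## §2 The registered stub -/

/-- **REGISTERED STUB `stub_telescopedCrux` OF THE GLUE SKELETON v6 (item stmt-QuantumFields-27139)**: crux `CutoffRenyiL` telescoped up the
cut-offs of a refined family `F.refine d` with the geometric orders `q_J = κL^(2J)` (`κ ≤ Q`, `κL^(2J₀) ≥ 3`), given interior masses `≥ 1/2`
on `[J₀, J]`: the unit-event mass at cut-off `J` is at most `exp((4/3)R₀κp(g_d)⁴L^(3(m+d))/L^(2J₀))·(u_(J₀)/P_(J₀))^(1/2)`.
[cite: Balaban1985UV3, (7) p.257 and (71) p.273; King1986, Thm 3.4 p.334] -/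
theorem stub_telescopedCrux :
    Summit.QuantumFields.YangMills.Theses.RenyiTelescope.CutoffRenyiL →
    (∀ (u P q D : ℕ → ℝ) (J₀ n : ℕ),
      (∀ J, J₀ ≤ J → J ≤ J₀ + n → 0 ≤ u J ∧ 0 < P J ∧ u J ≤ P J) →
      (∀ J, J₀ ≤ J → J < J₀ + n → 1 < q J ∧ 0 ≤ D J ∧
        u (J + 1) * P J ^ (1 - 1 / q J) ≤ Real.exp (D J) * u J ^ (1 - 1 / q J) * P (J + 1)) →
      P (J₀ + n) ≤ 1 → ∑ i ∈ Finset.range n, 1 / q (J₀ + i) ≤ 1 / 2 →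
      u (J₀ + n) ≤ Real.exp (∑ i ∈ Finset.range n, D (J₀ + i)) * (u J₀ / P J₀) ^ (1 / 2 : ℝ)) →
    ∀ (L : ℕ), ∃ (c b₁ p₁ : ℝ), 0 < c ∧ c ≤ 1 ∧ ∀ (b₀ p₀ : ℝ), b₁ ≤ b₀ → p₁ ≤ p₀ → 0 < b₀ → 2 < p₀ →
      ∃ (γ₁ Q R₀ : ℝ), 0 < γ₁ ∧ γ₁ ≤ 1 ∧ 0 < Q ∧ 0 ≤ R₀ ∧ ∀ (F : T3Family) (γ : ℝ), F.L = L → 0 < γ → γ ≤ γ₁ →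
        ∀ (d J₀ J : ℕ) (κ : ℝ) (p : Plaq ((F.refine d).P 0) 0), 1 ≤ J₀ → J₀ < J → 0 < κ → κ ≤ Q →
          3 ≤ κ * (F.L : ℝ) ^ (2 * J₀) →
          (∀ J', J₀ ≤ J' → J' ≤ J → 1 / 2 ≤ (gibbsK (F.refine d) ℰp (γ * ((F.L : ℝ)⁻¹) ^ d) J').real
              (histGoodInt (F.refine d) (θBal F.L (γ * ((F.L : ℝ)⁻¹) ^ d) b₀ p₀) (θBal F.L (γ * ((F.L : ℝ)⁻¹) ^ d) (c * b₀) p₀ 1) J' 1)) →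
          (gibbsK (F.refine d) ℰp (γ * ((F.L : ℝ)⁻¹) ^ d) J).real
              ((unitA (F.refine d) ℰp J) ⁻¹'
                {V | θBal F.L (γ * ((F.L : ℝ)⁻¹) ^ d) (c * b₀) p₀ 0 ≤ GaugeGroup.dist1 (GaugeField.plaqHol V p)} ∩
              histGoodInt (F.refine d) (θBal F.L (γ * ((F.L : ℝ)⁻¹) ^ d) b₀ p₀) (θBal F.L (γ * ((F.L : ℝ)⁻¹) ^ d) (c * b₀) p₀ 1) J 1) ≤
            Real.exp (4 / 3 * R₀ * κ * (B10.pFun b₀ p₀ (Real.sqrt (γ * ((F.L : ℝ)⁻¹) ^ d))) ^ 4 * (F.L : ℝ) ^ (3 * (F.m + d)) /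
                (F.L : ℝ) ^ (2 * J₀)) *
              ((gibbsK (F.refine d) ℰp (γ * ((F.L : ℝ)⁻¹) ^ d) J₀).real
                  ((unitA (F.refine d) ℰp J₀) ⁻¹'
                {V | θBal F.L (γ * ((F.L : ℝ)⁻¹) ^ d) (c * b₀) p₀ 0 ≤ GaugeGroup.dist1 (GaugeField.plaqHol V p)} ∩
              histGoodInt (F.refine d) (θBal F.L (γ * ((F.L : ℝ)⁻¹) ^ d) b₀ p₀) (θBal F.L (γ * ((F.L : ℝ)⁻¹) ^ d) (c * b₀) p₀ 1) J₀ 1) /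
                (gibbsK (F.refine d) ℰp (γ * ((F.L : ℝ)⁻¹) ^ d) J₀).real
                  (histGoodInt (F.refine d) (θBal F.L (γ * ((F.L : ℝ)⁻¹) ^ d) b₀ p₀) (θBal F.L (γ * ((F.L : ℝ)⁻¹) ^ d) (c * b₀) p₀ 1) J₀ 1)) ^ (1 / 2 : ℝ) := by
  intro hC hT L
  obtain ⟨c, b₁, p₁, hc, hc1, hC1⟩ := hC L
  refine ⟨c, b₁, p₁, hc, hc1, fun b₀ p₀ hb hp hb₀ hp₀ => ?_⟩
  obtain ⟨γ₁, Q, R₀, hγ₁, hγ₁1, hQ, hC2⟩ := hC1 b₀ p₀ hb hp hb₀ hp₀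
  refine ⟨γ₁, Q, max R₀ 0, hγ₁, hγ₁1, hQ, le_max_right _ _, ?_⟩
  intro F γ hFL hγ hγle d J₀ J κ p hJ₀ hJ₀J hκ hκQ hκ3 hpos
  subst hFL
  -- the refined family `F.refine d` at `γ_d = γL^(-d) ≤ γ ≤ γ₁`
  have hL2 : (2 : ℝ) ≤ F.L := by exact_mod_cast (show 2 ≤ F.L by have := F.hL.2; omega)
  have hL1 : (1 : ℝ) ≤ F.L := by linarith
  have hLinv : ((F.L : ℝ)⁻¹) ^ d ≤ 1 := pow_le_one₀ (inv_nonneg.mpr (by positivity)) (inv_le_one_of_one_le₀ hL1)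
  have hγ' : 0 < γ * ((F.L : ℝ)⁻¹) ^ d := mul_pos hγ (pow_pos (inv_pos.mpr (by positivity)) _)
  have hγ'le : γ * ((F.L : ℝ)⁻¹) ^ d ≤ γ₁ := (mul_le_of_le_one_right hγ.le hLinv).trans hγle
  have hA : MeasurableSet {V : GaugeField ((F.refine d).P 0) 0 (Matrix.specialUnitaryGroup (Fin 2) ℂ) |
      θBal F.L (γ * ((F.L : ℝ)⁻¹) ^ d) (c * b₀) p₀ 0 ≤ GaugeGroup.dist1 (GaugeField.plaqHol V p)} :=
    measurableSet_le measurable_const (RegularGaugeGroup.measurable_dist1.comp (Missing.measurable_plaqHol p))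
  have hq1 : ∀ J', J₀ ≤ J' → 1 < κ * (F.L : ℝ) ^ (2 * J') := by
    intro J' hJ'
    have : κ * (F.L : ℝ) ^ (2 * J₀) ≤ κ * (F.L : ℝ) ^ (2 * J') :=
      mul_le_mul_of_nonneg_left (pow_le_pow_right₀ hL1 (by omega)) hκ.le
    linarith
  obtain ⟨n, rfl⟩ : ∃ n, J = J₀ + n := ⟨J - J₀, by omega⟩
  -- the telescope with `u_J, P_J, q_J = κL^(2J), D_J = max(R₀,0)(q_J − 1)p⁴L^(3(m+d))/L^(4J)`
  have key := hT
    (fun J' => (gibbsK (F.refine d) ℰp (γ * ((F.L : ℝ)⁻¹) ^ d) J').real ((unitA (F.refine d) ℰp J') ⁻¹'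
                {V | θBal F.L (γ * ((F.L : ℝ)⁻¹) ^ d) (c * b₀) p₀ 0 ≤ GaugeGroup.dist1 (GaugeField.plaqHol V p)} ∩
              histGoodInt (F.refine d) (θBal F.L (γ * ((F.L : ℝ)⁻¹) ^ d) b₀ p₀) (θBal F.L (γ * ((F.L : ℝ)⁻¹) ^ d) (c * b₀) p₀ 1) J' 1))
    (fun J' => (gibbsK (F.refine d) ℰp (γ * ((F.L : ℝ)⁻¹) ^ d) J').real (histGoodInt (F.refine d) (θBal F.L (γ * ((F.L : ℝ)⁻¹) ^ d) b₀ p₀) (θBal F.L (γ * ((F.L : ℝ)⁻¹) ^ d) (c * b₀) p₀ 1) J' 1))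
    (fun J' => κ * (F.L : ℝ) ^ (2 * J'))
    (fun J' => max R₀ 0 * (κ * (F.L : ℝ) ^ (2 * J') - 1) * (B10.pFun b₀ p₀ (Real.sqrt (γ * ((F.L : ℝ)⁻¹) ^ d))) ^ 4 *
      (F.L : ℝ) ^ (3 * (F.m + d)) / (F.L : ℝ) ^ (4 * J'))
    J₀ n ?_ ?_ ?_ (order_budget hL2 hκ hκ3 n)
  · -- conclusion: bound the summed exponent
    refine key.trans (mul_le_mul_of_nonneg_right (Real.exp_le_exp.mpr ?_) (Real.rpow_nonneg (div_nonneg measureReal_nonneg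
      measureReal_nonneg) _))
    exact exponent_budget hL2 hκ (le_max_right _ _) (by positivity) (by positivity) J₀ n
  · -- masses: `0 ≤ u ≤ P`, `0 < P` (interior masses ≥ 1/2)
    intro J' h1 h2
    haveI := isProbabilityMeasure_gibbsK (F.refine d) ℰp hγ'.le J'
    exact ⟨measureReal_nonneg, lt_of_lt_of_le (by norm_num) (hpos J' h1 h2),
      measureReal_mono Set.inter_subset_right (measure_ne_top _ _)⟩
  · -- the one-step inequality = crux `CutoffRenyiL` for `F.refine d` at order `q_J`
    intro J' h1 h2
    have hq := hq1 J' h1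
    have hqm : 0 ≤ κ * (F.L : ℝ) ^ (2 * J') - 1 := by linarith
    have hD0 : 0 ≤ max R₀ 0 * (κ * (F.L : ℝ) ^ (2 * J') - 1) * (B10.pFun b₀ p₀ (Real.sqrt (γ * ((F.L : ℝ)⁻¹) ^ d))) ^ 4 *
        (F.L : ℝ) ^ (3 * (F.m + d)) / (F.L : ℝ) ^ (4 * J') := by positivity
    refine ⟨hq, hD0, ?_⟩
    have h27 := hC2 (F.refine d) (γ * ((F.L : ℝ)⁻¹) ^ d) rfl hγ' hγ'le J' (κ * (F.L : ℝ) ^ (2 * J')) (le_trans hJ₀ h1) hq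
      (mul_le_mul_of_nonneg_right hκQ (by positivity)) _ hA
    refine h27.trans (mul_le_mul_of_nonneg_right (mul_le_mul_of_nonneg_right (Real.exp_le_exp.mpr ?_)
      (Real.rpow_nonneg measureReal_nonneg _)) measureReal_nonneg)
    have hW : 0 ≤ (κ * (F.L : ℝ) ^ (2 * J') - 1) * (B10.pFun b₀ p₀ (Real.sqrt (γ * ((F.L : ℝ)⁻¹) ^ d))) ^ 4 *
        (F.L : ℝ) ^ (3 * (F.m + d)) / (F.L : ℝ) ^ (4 * J') := by positivity
    calc R₀ * (κ * (F.L : ℝ) ^ (2 * J') - 1) * (B10.pFun b₀ p₀ (Real.sqrt (γ * ((F.L : ℝ)⁻¹) ^ d))) ^ 4 *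
          (F.L : ℝ) ^ (3 * (F.refine d).m) / (F.L : ℝ) ^ (4 * J')
        = R₀ * ((κ * (F.L : ℝ) ^ (2 * J') - 1) * (B10.pFun b₀ p₀ (Real.sqrt (γ * ((F.L : ℝ)⁻¹) ^ d))) ^ 4 *
          (F.L : ℝ) ^ (3 * (F.m + d)) / (F.L : ℝ) ^ (4 * J')) := by rw [T3Family.refine_m]; ring
      _ ≤ max R₀ 0 * ((κ * (F.L : ℝ) ^ (2 * J') - 1) * (B10.pFun b₀ p₀ (Real.sqrt (γ * ((F.L : ℝ)⁻¹) ^ d))) ^ 4 *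
          (F.L : ℝ) ^ (3 * (F.m + d)) / (F.L : ℝ) ^ (4 * J')) := mul_le_mul_of_nonneg_right (le_max_left _ _) hW
      _ = max R₀ 0 * (κ * (F.L : ℝ) ^ (2 * J') - 1) * (B10.pFun b₀ p₀ (Real.sqrt (γ * ((F.L : ℝ)⁻¹) ^ d))) ^ 4 *
          (F.L : ℝ) ^ (3 * (F.m + d)) / (F.L : ℝ) ^ (4 * J') := by ring
  · -- `P ≤ 1`
    haveI := isProbabilityMeasure_gibbsK (F.refine d) ℰp hγ'.le (J₀ + n)
    exact measureReal_le_one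

end Summit.QuantumFields.YangMills.Theorems.RenyiTelescope

end
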